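import Summits.HubbardSuperconductivity.HubbardSuperconductivity.Theorems.WindowInfraredBound.Negative.NearGroundStatesTwist
import Literature.MathematicalPhysics.QuantumLattice.PairFieldMomentum

/-!
# Crux `WindowInfraredBound` (item `stmt-HubbardSuperconductivity-1089`), negative side:
# with `d`-wave order, NO energy window above the ground state can replace the ground-state hypothesis

`not_windowBoundNearGroundStates_of_dWaveLRO`.  Suppose that at some `(U, δ)` the torus ground states
carry `d`-wave pair long-range order along a sequence (for all large even `L`, SOME normalised
`(N_L, 0)`-sector ground state `ψ_L` of `hubbardTorus 2 L 1 U` has `‖Δ_d ψ_L‖² ≥ a L⁴`, `a > 0` — the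
summit's conclusion for that sequence).  Then the crux `WindowInfraredBound` becomes FALSE as soon as its
ground-state hypothesis `IsGroundStateInSector H_L N_L 0 ψ` is relaxed to
"`ψ` is a unit vector of the sector with energy `Re ⟨ψ, H_L ψ⟩ ≤ minEnergyOn H_L (szSector N_L 0) + 8π²`":
a FIXED, `L`-INDEPENDENT energy window of width `8π²` (in units of the hopping) above the ground energy
already contains normalised sector vectors with `Θ(L²)` pair weight at the smallest window momenta.

WITNESS: the Lieb–Schultz–Mattis twist `G_j ψ_L`, `j = ±1` (`G_j = phaseGauge (twistGauge L (2πj))`); the two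
lemmas below live in `…/Negative/NearGroundStatesTwist.lean`.
* ENERGY (`exists_twist_energy_le`): `Re ⟨G_jψ, H G_jψ⟩ = Re ⟨ψ, Hψ⟩ + 2(1 − cos(2π/L)) K₁(ψ) ± 2 sin(2π/L) J₁(ψ)`
  (the tree's `phaseGauge_conj_hubbardTorus_add_smul` and
  `re_star_dotProduct_magneticHubbardTorus_uniformTwistConfig_mulVec`: integer flux quanta are a pure
  gauge); choosing the sign of `j` against the current `J₁(ψ)` and using `|K₁| ≤ 2L²`
  (`WindowGap.Negative.abs_kineticWeight_le`), `1 − cos x ≤ x²/2`, the excess is `≤ 8π²`.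
* PAIR WEIGHT (`re_pairFieldAt_twist_ge`): `Δ_d(−2jê₁) G_j = G_j Σ_e conj χ_{jê₁}(e) Δ_{d·1_e}(0)`
  (`conjTranspose_twist_mul_pairFieldAt_single_mul`), and `Σ_e conj χ_{jê₁}(e) Δ_{d·1_e} = Δ_d + R` with
  `‖Rψ‖ ≤ 2 · (2π/L) · √2 L²` (only the two horizontal bonds are dephased, by `|e^{∓2πi/L} − 1| ≤ 2π/L`),
  so `‖Δ_d(−2jê₁) G_jψ‖² ≥ ‖Δ_dψ‖²/2 − 32π²L² ≥ aL⁴/2 − 32π²L²`: the twist carries the `k = 0` condensate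
  to the window momentum `|q| = 4π/L` intact up to `O(L)`.
* So at `ε < a/(8(C+1))`, `L ≥ 4π/ε`, `L² ≥ 128π²/a` the relaxed bound `T_ε ≤ CεL²` fails.

READING.  In the superconducting phase the crux is a statement about EXACT eigenvectors at the bottom of
the tower of states: every vector `G_jψ` lies within `8π²` of the ground energy and violates the window
bound maximally.  No argument that only uses "energy within `O(1)` (or `o(εL²)`) of the ground state" —
variational closeness, approximate ground states, Kac-type energy differences at resolution coarser than
`O(1)` TOTAL — can prove the crux where the routes need it.  (Unconditionally, over ALL sector states, the
bound fails by `…/Negative/AllSectorStates.lean`.)  No parameter point is claimed: the LRO hypothesis is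
the open summit-level input.  Negative / support for the crux (`--supports stmt-HubbardSuperconductivity-1089`);
no definitions, no named facts.
Sources: E. Lieb, T. Schultz, D. Mattis, Ann. Phys. 16 (1961) 407; H. Watanabe, J. Stat. Phys. 177 (2019)
717, §2.2.1; H. Tasaki (2020) §2.1; D. J. Scalapino, Phys. Rep. 250 (1995) 329, §2.
-/

-- the mandated namespace `Summit.<Summit>.<Problem>.Theorems` repeats `HubbardSuperconductivity`
-- (single-problem summit, D-0017), which the `dupNamespace` linter flags on every declaration
set_option linter.dupNamespace false

noncomputable section

namespace Summit.HubbardSuperconductivity.HubbardSuperconductivity.Theorems.WindowInfraredBound.Negative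

open Literature.MathematicalPhysics.QuantumLattice Literature.MathematicalPhysics.QuantumFieldTheory
  Literature.Probability.LatticeModels Matrix Finset
open scoped Matrix.Norms.L2Operator ComplexOrder ComplexConjugate

/-! ### The refutation of the energy-window relaxation, given `d`-wave order -/

/-- **With `d`-wave order, no `O(1)` energy window replaces the ground-state hypothesis.** If at some
`(U, δ)`, for all large even `L`, SOME normalised `(N_L, 0)`-sector ground state `ψ_L` of
`hubbardTorus 2 L 1 U` (`N_L = 2⌊(1−δ)L²/2⌋`) has `Re ⟨Δ_dψ_L, Δ_dψ_L⟩ ≥ aL⁴` (`a > 0`), then the crux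
`WindowInfraredBound` with `IsGroundStateInSector` relaxed to "unit vector of the sector with
`Re ⟨ψ, Hψ⟩ ≤ minEnergyOn H (szSector N_L 0) + 8π²`" is FALSE: given its `C, ε₀, L₀` at that `(U, δ)`, take
`ε = min ε₀ (a/(8(C+1)))` and an even `L ≥ max L₀ L₁ (4π/ε) (128π²/a)`, `L ≥ 6`; the twisted ground state
`G_jψ_L` of `exists_twist_energy_le` is admissible (`phaseGauge_mulVec_mem_szSector`, isometry) and has
`T_ε(G_jψ_L) ≥ S(−2jê₁) ≥ aL²/2 − 32π² > aL²/8 > CεL²` (`re_pairFieldAt_twist_ge`).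
Lieb–Schultz–Mattis (1961); Watanabe (2019) §2.2.1; Scalapino (1995) §2. [folklore] -/
theorem not_windowBoundNearGroundStates_of_dWaveLRO
    (hLRO : ∃ U : ℝ, 0 < U ∧ ∃ δ ∈ Set.Ioo (0:ℝ) (1 / 2), ∃ a : ℝ, 0 < a ∧ ∃ L₁ : ℕ,
      ∀ (L : ℕ) [NeZero L], L₁ ≤ L → Even L →
        ∃ ψ : Fock (Orb (FermionTorus 2 L)), star ψ ⬝ᵥ ψ = 1 ∧
          IsGroundStateInSector (hubbardTorus 2 L 1 U) (2 * ⌊(1 - δ) * (L : ℝ) ^ 2 / 2⌋₊) 0 ψ ∧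
          a * (L : ℝ) ^ 4 ≤
            (star (pairField dWaveFormFactor L *ᵥ ψ) ⬝ᵥ (pairField dWaveFormFactor L *ᵥ ψ)).re) :
    ¬ (∀ U : ℝ, 0 < U → ∀ δ ∈ Set.Ioo (0:ℝ) (1 / 2), ∃ C ε₀ : ℝ, 0 ≤ C ∧ 0 < ε₀ ∧ ∃ L₀ : ℕ,
        ∀ ε ∈ Set.Ioc (0:ℝ) ε₀, ∀ (L : ℕ) [NeZero L], L₀ ≤ L → Even L →
          ∀ ψ : Fock (Orb (FermionTorus 2 L)), star ψ ⬝ᵥ ψ = 1 →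
            ψ ∈ szSector (Λ := FermionTorus 2 L) (2 * ⌊(1 - δ) * (L : ℝ) ^ 2 / 2⌋₊) 0 →
            (star ψ ⬝ᵥ (hubbardTorus 2 L 1 U *ᵥ ψ)).re ≤
              (hubbardTorus 2 L 1 U).minEnergyOn
                (szSector (Λ := FermionTorus 2 L) (2 * ⌊(1 - δ) * (L : ℝ) ^ 2 / 2⌋₊) 0) + 8 * Real.pi ^ 2 →
              (∑ m : TorusSite 2 L, if m ≠ 0 ∧ momentumNormSq L m ≤ ε ^ 2 then
                  pairStructureFactor dWaveFormFactor L ψ m else 0) ≤ C * ε * (L : ℝ) ^ 2) := by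
  intro h
  obtain ⟨U, hU, δ, hδ, a, ha, L₁, hGS⟩ := hLRO
  obtain ⟨C, ε₀, hC, hε₀, L₀, hB⟩ := h U hU δ hδ
  -- the window radius
  obtain ⟨ε, hεdef⟩ : ∃ ε : ℝ, ε = min ε₀ (a / (8 * (C + 1))) := ⟨_, rfl⟩
  have hεpos : 0 < ε := by rw [hεdef]; exact lt_min hε₀ (by positivity)
  have hεε₀ : ε ≤ ε₀ := by rw [hεdef]; exact min_le_left _ _
  have hεC : 8 * (C + 1) * ε ≤ a := by
    have h1 : ε ≤ a / (8 * (C + 1)) := by rw [hεdef]; exact min_le_right _ _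
    rw [le_div_iff₀ (by positivity)] at h1
    linarith
  -- the torus side
  obtain ⟨n, hndef⟩ : ∃ n : ℕ, n = L₀ + L₁ + ⌈4 * Real.pi / ε⌉₊ + ⌈128 * Real.pi ^ 2 / a⌉₊ + 3 :=
    ⟨_, rfl⟩
  obtain ⟨L, hLdef⟩ : ∃ L : ℕ, L = 2 * n := ⟨_, rfl⟩
  have hL6 : 6 ≤ L := by omega
  haveI : NeZero L := ⟨by omega⟩
  have hL₀ : L₀ ≤ L := by omega
  have hL₁ : L₁ ≤ L := by omega
  have hL3 : 3 ≤ L := by omega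
  have hEven : Even L := ⟨n, by omega⟩
  have hLr : (0 : ℝ) < L := by exact_mod_cast (show 0 < L by omega)
  have hnr : (n : ℝ) ≤ L := by exact_mod_cast (show n ≤ L by omega)
  have h4π : 4 * Real.pi / ε ≤ L := by
    have h1 := Nat.le_ceil (4 * Real.pi / ε)
    have h2 : ((⌈4 * Real.pi / ε⌉₊ : ℕ) : ℝ) ≤ n := by
      rw [hndef]; push_cast
      linarith [show (0:ℝ) ≤ L₀ from Nat.cast_nonneg _, show (0:ℝ) ≤ L₁ from Nat.cast_nonneg _,
        show (0:ℝ) ≤ ⌈128 * Real.pi ^ 2 / a⌉₊ from Nat.cast_nonneg _]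
    linarith
  have h128 : 128 * Real.pi ^ 2 / a ≤ (L : ℝ) ^ 2 := by
    have h1 := Nat.le_ceil (128 * Real.pi ^ 2 / a)
    have h2 : ((⌈128 * Real.pi ^ 2 / a⌉₊ : ℕ) : ℝ) ≤ n := by
      rw [hndef]; push_cast
      linarith [show (0:ℝ) ≤ L₀ from Nat.cast_nonneg _, show (0:ℝ) ≤ L₁ from Nat.cast_nonneg _,
        show (0:ℝ) ≤ ⌈4 * Real.pi / ε⌉₊ from Nat.cast_nonneg _]
    have h1L : (1 : ℝ) ≤ L := by exact_mod_cast (show 1 ≤ L by omega)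
    have h3 : (L : ℝ) ≤ (L : ℝ) ^ 2 := by nlinarith
    linarith
  -- the ordered ground state and its twist
  obtain ⟨ψ, hψ1, hψGS, hψa⟩ := hGS L hL₁ hEven
  obtain ⟨j, hj, hjE⟩ := exists_twist_energy_le hL3 U hψ1
  have hGu : ∀ v, (phaseGauge fun u : FermionTorus 2 L => twistGauge L (j * (2 * Real.pi)) u.toTorusSite)ᴴ *ᵥ
      (phaseGauge (fun u : FermionTorus 2 L => twistGauge L (j * (2 * Real.pi)) u.toTorusSite) *ᵥ v) = v :=
    conjTranspose_phaseGauge_mulVec_phaseGauge_mulVec _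
  have hφ1 : star (phaseGauge (fun u : FermionTorus 2 L => twistGauge L (j * (2 * Real.pi)) u.toTorusSite) *ᵥ ψ) ⬝ᵥ
      (phaseGauge (fun u : FermionTorus 2 L => twistGauge L (j * (2 * Real.pi)) u.toTorusSite) *ᵥ ψ) = 1 := by
    rw [star_mulVec_dotProduct_self_of_unitary hGu, hψ1]
  have hφmem := phaseGauge_mulVec_mem_szSector
    (fun u : FermionTorus 2 L => twistGauge L (j * (2 * Real.pi)) u.toTorusSite) hψGS.1
  -- the ground-state energy identity `Re ⟨ψ, Hψ⟩ = minEnergyOn`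
  have hE0 : (star ψ ⬝ᵥ (hubbardTorus 2 L 1 U *ᵥ ψ)).re =
      (hubbardTorus 2 L 1 U).minEnergyOn
        (szSector (Λ := FermionTorus 2 L) (2 * ⌊(1 - δ) * (L : ℝ) ^ 2 / 2⌋₊) 0) := by
    rw [hψGS.2.2, dotProduct_smul, hψ1, smul_eq_mul, mul_one, Complex.ofReal_re]
  have hφE : (star (phaseGauge (fun u : FermionTorus 2 L => twistGauge L (j * (2 * Real.pi)) u.toTorusSite) *ᵥ ψ) ⬝ᵥ
      (hubbardTorus 2 L 1 U *ᵥ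
        (phaseGauge (fun u : FermionTorus 2 L => twistGauge L (j * (2 * Real.pi)) u.toTorusSite) *ᵥ ψ))).re ≤
      (hubbardTorus 2 L 1 U).minEnergyOn
        (szSector (Λ := FermionTorus 2 L) (2 * ⌊(1 - δ) * (L : ℝ) ^ 2 / 2⌋₊) 0) + 8 * Real.pi ^ 2 := by
    rw [← hE0]; exact hjE
  have hmain := hB ε ⟨hεpos, hεε₀⟩ L hL₀ hEven _ hφ1 hφmem hφE
  -- the window momentum `m = −2jê₁`
  obtain ⟨m₀, hm₀⟩ : ∃ m₀ : TorusSite 2 L, m₀ = -(Pi.single 0 (((2 * j : ℤ)) : ZMod L)) := ⟨_, rfl⟩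
  have hm₀1 : m₀ 1 = 0 := by
    rw [hm₀, Pi.neg_apply, Pi.single_eq_of_ne (by decide : (1 : Fin 2) ≠ 0), neg_zero]
  have hval : ((m₀ 0).valMinAbs : ℝ) ^ 2 = 4 := by
    have h2 : ((2 : ℕ) : ZMod L).valMinAbs = (2 : ℕ) := ZMod.valMinAbs_natCast_of_le_half (by omega)
    rcases hj with rfl | rfl
    · have hm : m₀ 0 = -((2 : ℕ) : ZMod L) := by
        rw [hm₀, Pi.neg_apply, Pi.single_eq_same]; push_cast; ring
      have hne : 2 * ((2 : ℕ) : ZMod L).val ≠ L := by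
        rw [ZMod.val_natCast, Nat.mod_eq_of_lt (by omega)]; omega
      rw [hm, ZMod.valMinAbs_neg_of_ne_half hne, h2]; push_cast; norm_num
    · have hm : m₀ 0 = ((2 : ℕ) : ZMod L) := by
        rw [hm₀, Pi.neg_apply, Pi.single_eq_same]; push_cast; ring
      rw [hm, h2]; push_cast; norm_num
  have hm₀ne : m₀ ≠ 0 := by
    intro h0
    have h2 : ((m₀ 0).valMinAbs : ℝ) ^ 2 = 0 := by
      rw [h0, Pi.zero_apply, ZMod.valMinAbs_zero]; norm_num
    linarith
  have hnorm : momentumNormSq L m₀ ≤ ε ^ 2 := by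
    rw [momentumNormSq_apply, Fin.sum_univ_two, hval, hm₀1, ZMod.valMinAbs_zero]
    push_cast
    have h1 : 4 * Real.pi ≤ ε * L := by
      rw [div_le_iff₀ hεpos] at h4π
      linarith
    have h2 : 2 * Real.pi / (L : ℝ) * 2 ≤ ε := by
      rw [div_mul_eq_mul_div, div_le_iff₀ hLr]
      linarith
    have h3 : 0 ≤ 2 * Real.pi / (L : ℝ) * 2 := by positivity
    nlinarith [mul_self_le_mul_self h3 h2]
  -- the window sum is at least its `m₀` term, which is `≥ aL²/2 − 32π²`
  have hterm : pairStructureFactor dWaveFormFactor L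
      (phaseGauge (fun u : FermionTorus 2 L => twistGauge L (j * (2 * Real.pi)) u.toTorusSite) *ᵥ ψ) m₀ ≤
      ∑ m : TorusSite 2 L, if m ≠ 0 ∧ momentumNormSq L m ≤ ε ^ 2 then
        pairStructureFactor dWaveFormFactor L
          (phaseGauge (fun u : FermionTorus 2 L => twistGauge L (j * (2 * Real.pi)) u.toTorusSite) *ᵥ ψ) m
        else 0 := by
    have h0 : (if m₀ ≠ 0 ∧ momentumNormSq L m₀ ≤ ε ^ 2 then
        pairStructureFactor dWaveFormFactor L
          (phaseGauge (fun u : FermionTorus 2 L => twistGauge L (j * (2 * Real.pi)) u.toTorusSite) *ᵥ ψ) m₀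
        else 0) = pairStructureFactor dWaveFormFactor L
          (phaseGauge (fun u : FermionTorus 2 L => twistGauge L (j * (2 * Real.pi)) u.toTorusSite) *ᵥ ψ) m₀ :=
      if_pos ⟨hm₀ne, hnorm⟩
    rw [← h0]
    exact Finset.single_le_sum (f := fun m => if m ≠ 0 ∧ momentumNormSq L m ≤ ε ^ 2 then
        pairStructureFactor dWaveFormFactor L
          (phaseGauge (fun u : FermionTorus 2 L => twistGauge L (j * (2 * Real.pi)) u.toTorusSite) *ᵥ ψ) m
        else 0)
      (fun m _ => by
        split_ifs
        · exact pairStructureFactor_nonneg _ _ _ _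
        · exact le_rfl)
      (Finset.mem_univ _)
  have hS : a * (L : ℝ) ^ 2 / 2 - 32 * Real.pi ^ 2 ≤ pairStructureFactor dWaveFormFactor L
      (phaseGauge (fun u : FermionTorus 2 L => twistGauge L (j * (2 * Real.pi)) u.toTorusSite) *ᵥ ψ) m₀ := by
    have h := re_pairFieldAt_twist_ge hL3 hj hψ1
    rw [← hm₀] at h
    have hL2 : (0 : ℝ) < (L : ℝ) ^ 2 := by positivity
    rw [pairStructureFactor_apply, le_div_iff₀ hL2]
    have h' : a * (L : ℝ) ^ 4 / 2 - 32 * Real.pi ^ 2 * (L : ℝ) ^ 2 ≤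
        (star (pairField dWaveFormFactor L *ᵥ ψ) ⬝ᵥ (pairField dWaveFormFactor L *ᵥ ψ)).re / 2 -
          32 * Real.pi ^ 2 * (L : ℝ) ^ 2 := by linarith
    calc (a * (L : ℝ) ^ 2 / 2 - 32 * Real.pi ^ 2) * (L : ℝ) ^ 2
        = a * (L : ℝ) ^ 4 / 2 - 32 * Real.pi ^ 2 * (L : ℝ) ^ 2 := by ring
      _ ≤ _ := h'.trans h
  -- contradiction: `aL²/2 − 32π² ≤ CεL² ≤ aL²/8 − εL²` while `L² ≥ 128π²/a`
  have hup : C * ε * (L : ℝ) ^ 2 ≤ a * (L : ℝ) ^ 2 / 8 - ε * (L : ℝ) ^ 2 := by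
    have h1 : C * ε ≤ a / 8 - ε := by linarith
    have hL2 : (0 : ℝ) ≤ (L : ℝ) ^ 2 := by positivity
    nlinarith
  have hlow : 32 * Real.pi ^ 2 ≤ a * (L : ℝ) ^ 2 / 4 := by
    rw [div_le_iff₀ ha] at h128
    linarith
  have hεL : 0 < ε * (L : ℝ) ^ 2 := by positivity
  have haL : 0 ≤ a * (L : ℝ) ^ 2 := by positivity
  linarith [hS, hterm, hmain, hup, hlow]

end Summit.HubbardSuperconductivity.HubbardSuperconductivity.Theorems.WindowInfraredBound.Negative
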